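import Mathlib
import HarnessLib.Audit
import Summits.PneNP.PneNP.Theorems.ClusOshDown

/-!
# Route ClusUniversalCertificate — F4: the canonical bijection `τ_Y : Y → osh(Y)` with `τ_Y(y) ⊆ Z(y)` (osh-P2.md §2 F4)
(rung F-N1, cell pnp-ideate, crux `UniversalCertAll` = stmt-PneNP-19683; planner p1 g14, `lines/osh-P2.md` F4: "τ_Y(w,σ) := τ_U(w) for single-level w, and for w ∈ I:
τ_Y(w,0) := τ_I(w) ∪ {M}, τ_Y(w,1) := τ_U(w); then τ_Y is a bijection onto osh(Y) with τ_Y(y) ⊆ Z(y)" — the source of the pointwise gap `G1(y) = z(y) − |τ_Y(y)| ≥ 0`;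
restricted-model combinatorics — nothing here bears on `P` versus `NP`)

* `tau N Y y` — the recursive assignment; `tau_subset_zeros` (`τ_Y(y) ⊆ Z(y)`, so `|τ_Y(y)| ≤ z(y)`), `colexStd_tau` (`τ_Y(y) ∈ osh(Y)` for `y ∈ Y`), `tau_injOn`
  (injective on `Y`), `image_tau` (its image is exactly `osh(Y)`, by counting with `oshCount_top`);
* `oshS_eq_sum_card_tau` — hence `S(Y) = Σ_{y ∈ Y} |τ_Y(y)|` and the cheap universal bound `oshS_le_sum_zeros`: `S(Y) ≤ Σ_y z(y)`.
-/

set_option linter.dupNamespace false -- `Summit.PneNP.PneNP.…`: summit = sub-problem name (D-0017 single-conjunct layout)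

namespace Summit.PneNP.PneNP.Theorems.ClusHilbert.Osh

open Finset
open Summit.PneNP.PneNP.Theorems.ClusCube (V)

/-- **The canonical assignment `τ_Y(y)`**, by recursion on the dimension along the largest coordinate. -/
noncomputable def tau : (N : ℕ) → Finset (V N) → V N → Finset (Fin N)
  | 0, _, _ => ∅
  | N + 1, Y, y =>
    if y (Fin.last N) = 0 ∧ Fin.init y ∈ dbl Y then insert (Fin.last N) (emb (tau N (dbl Y) (Fin.init y)))
    else emb (tau N (proj Y) (Fin.init y))

/-- the zero set `Z(y)` of a point -/
def zeros {N : ℕ} (y : V N) : Finset (Fin N) := univ.filter fun i => y i = 0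

/-- **`τ_Y(y) ⊆ Z(y)`.** -/
theorem tau_subset_zeros : ∀ (N : ℕ) (Y : Finset (V N)) (y : V N), tau N Y y ⊆ zeros y := by
  intro N
  induction N with
  | zero => intro Y y; exact fun i _ => i.elim0
  | succ N ih =>
    intro Y y a ha
    unfold tau at ha
    unfold zeros
    rw [mem_filter]
    refine ⟨mem_univ _, ?_⟩
    have hemb : ∀ Z : Finset (V N), a ∈ emb (tau N Z (Fin.init y)) → y a = 0 := by
      intro Z h
      unfold emb at h
      obtain ⟨j, hj, rfl⟩ := mem_image.1 h
      have := ih Z (Fin.init y) hj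
      unfold zeros at this
      exact (mem_filter.1 this).2
    split_ifs at ha with h
    · rcases mem_insert.1 ha with rfl | ha
      · exact h.1
      · exact hemb _ ha
    · exact hemb _ ha

/-- Hence `|τ_Y(y)| ≤ z(y)`. -/
theorem card_tau_le {N : ℕ} (Y : Finset (V N)) (y : V N) : (tau N Y y).card ≤ (zeros y).card := card_le_card (tau_subset_zeros N Y y)

/-- **`τ_Y(y)` is colex-standard for `Y`** when `y ∈ Y`. -/
theorem colexStd_tau : ∀ (N : ℕ) (Y : Finset (V N)) (y : V N), y ∈ Y → colexStd Y (tau N Y y) := by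
  intro N
  induction N with
  | zero => intro Y y hy; exact (colexStd_empty_iff Y).2 ⟨y, hy⟩
  | succ N ih =>
    intro Y y hy
    unfold tau
    split_ifs with h
    · rw [colexStd_insert]
      exact ih _ _ h.2
    · rw [colexStd_emb]
      exact ih _ _ (init_mem_proj hy)

/-- **`τ_Y` is injective on `Y`.** -/
theorem tau_injOn : ∀ (N : ℕ) (Y : Finset (V N)), Set.InjOn (tau N Y) Y := by
  intro N
  induction N with
  | zero => intro Y y _ y' _ _; exact funext fun i => i.elim0
  | succ N ih =>
    intro Y y hy y' hy' h
    have key : ∀ {y y' : V (N + 1)}, y ∈ Y → y' ∈ Y → tau (N + 1) Y y = tau (N + 1) Y y' →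
        (y (Fin.last N) = 0 ∧ Fin.init y ∈ dbl Y) → y = y' := by
      intro y y' hy hy' h hc
      unfold tau at h
      rw [if_pos hc] at h
      by_cases hc' : y' (Fin.last N) = 0 ∧ Fin.init y' ∈ dbl Y
      · rw [if_pos hc'] at h
        have h1 : emb (tau N (dbl Y) (Fin.init y)) = emb (tau N (dbl Y) (Fin.init y')) := by
          have := congrArg (fun T => T.erase (Fin.last N)) h
          simpa only [erase_insert (last_notMem_emb _)] using this
        have h2 := ih (dbl Y) hc.2 hc'.2 (emb_injective h1)
        rw [← Fin.snoc_init_self y, ← Fin.snoc_init_self y', h2, hc.1, hc'.1]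
      · rw [if_neg hc'] at h
        exact absurd (h ▸ mem_insert_self (Fin.last N) _) (last_notMem_emb _)
    by_cases hc : y (Fin.last N) = 0 ∧ Fin.init y ∈ dbl Y
    · exact key hy hy' h hc
    by_cases hc' : y' (Fin.last N) = 0 ∧ Fin.init y' ∈ dbl Y
    · exact (key hy' hy h.symm hc').symm
    -- both on the `emb` branch: same projection, and the levels agree
    unfold tau at h
    rw [if_neg hc, if_neg hc'] at h
    have hw : Fin.init y = Fin.init y' := ih (proj Y) (init_mem_proj hy) (init_mem_proj hy') (emb_injective h)
    -- if the last coordinates differed, the common projection would be a double point at level 0 for one of them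
    have hl : y (Fin.last N) = y' (Fin.last N) := by
      by_contra hne
      rcases (by decide : ∀ a b : ZMod 2, a ≠ b → (a = 0 ∧ b = 1) ∨ (a = 1 ∧ b = 0)) _ _ hne with ⟨h0, h1⟩ | ⟨h1, h0⟩
      · apply hc
        refine ⟨h0, mem_dbl.2 ⟨?_, ?_⟩⟩
        · rw [← h0, Fin.snoc_init_self]; exact hy
        · rw [hw, ← h1, Fin.snoc_init_self]; exact hy'
      · apply hc'
        refine ⟨h0, mem_dbl.2 ⟨?_, ?_⟩⟩
        · rw [← h0, Fin.snoc_init_self]; exact hy'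
        · rw [← hw, ← h1, Fin.snoc_init_self]; exact hy
    rw [← Fin.snoc_init_self y, ← Fin.snoc_init_self y', hw, hl]

open Classical in
/-- **The image of `τ_Y` on `Y` is exactly `osh(Y)`** (injective into a set of the same size, `oshCount_top`). -/
theorem image_tau {N : ℕ} (Y : Finset (V N)) : Y.image (tau N Y) = univ.filter fun T => colexStd Y T := by
  classical
  refine eq_of_subset_of_card_le (fun T hT => ?_) ?_
  · obtain ⟨y, hy, rfl⟩ := mem_image.1 hT
    exact mem_filter.2 ⟨mem_univ _, colexStd_tau N Y y hy⟩
  · rw [card_image_of_injOn (tau_injOn N Y)]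
    have h := oshCount_top Y
    unfold oshCount at h
    rw [← h]
    exact card_le_card (fun T hT => mem_filter.2 ⟨mem_univ _, (mem_filter.1 hT).2, (card_le_univ T).trans (by rw [Fintype.card_fin])⟩)

open Classical in
/-- **`S(Y) = Σ_{y ∈ Y} |τ_Y(y)|`.** -/
theorem oshS_eq_sum_card_tau {N : ℕ} (Y : Finset (V N)) : oshS Y = ∑ y ∈ Y, (tau N Y y).card := by
  classical
  unfold oshS
  rw [← sum_filter, ← image_tau, sum_image (tau_injOn N Y)]

/-- **The cheap universal bound `S(Y) ≤ Σ_y z(y)`** (osh-P2.md F2/F4). -/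
theorem oshS_le_sum_zeros {N : ℕ} (Y : Finset (V N)) : oshS Y ≤ ∑ y ∈ Y, (zeros y).card := by
  rw [oshS_eq_sum_card_tau]
  exact sum_le_sum fun y _ => card_tau_le Y y

end Summit.PneNP.PneNP.Theorems.ClusHilbert.Osh
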